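import Summits.NavierStokesRegularity.NavierStokesRegularity.Theorems.SelfMixingDichotomyCoherentScaleExclusionKinWitnessSmooth
import Summits.NavierStokesRegularity.NavierStokesRegularity.Theorems.SelfMixingDichotomyCoherentScaleExclusionKinWitnessDivFree
import Summits.NavierStokesRegularity.NavierStokesRegularity.Theorems.SelfMixingDichotomyCoherentScaleExclusionSelfSimilarSwirlPointwise
import Summits.NavierStokesRegularity.NavierStokesRegularity.Theorems.SelfMixingDichotomyCoherentScaleExclusionSelfSimilarSwirlLoadFloor
import Summits.NavierStokesRegularity.NavierStokesRegularity.Theorems.SelfMixingDichotomyCoherentScaleExclusionSelfSimilarSwirlLoadCeiling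
import Literature.Analysis.FluidPDE.ClassicalSolution
import Literature.Analysis.FluidPDE.NSWave0
import Literature.Analysis.FluidPDE.SuitableWeak
import HarnessLib

/-!
# Route SelfMixingDichotomy — crux `SequentialTypeIExclusion` (S1, stmt-NavierStokesRegularity-1424), line `registered`,
# lead c6: the PULSATING kinematic witness — no-scale-intermittency (NSI) is not a kinematic fact

Sub-skeleton (lead c6) of the support package `…SequentialTypeIExclusionPulsatingWitness*`: the open stub
`stub_windowsForceTypeI` (NSI: Type-I windows `C(r_k; T, x₀) ≤ M`, `r_k → 0`, force a centred cubic Type-I bound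
`sup_{0<r<r₁} C(r) < ∞`) with its Navier–Stokes class replaced by the KINEMATIC class — smooth space–time field on
`[0,T) × ℝ³`, divergence free at every time, uniformly bounded energy from time `0`, rapidly decaying (here: zero)
datum — is FALSE. Witness (`T = 1`, `x₀ = 0`): the pulsating self-similar swirling eddy

  `u t x = (a t · (1 − t)⁻¹ · expNegInvGlue (4 − ‖x‖²/(1 − t))) • (−x₁, x₀, 0)`   (`t < 1`; `0` after),

the regime-A eddy of the sibling crux S2 (`…CoherentScaleExclusionSelfSimilarSwirl*`, amplitude `A`) with a
time-dependent amplitude `a`: `a = 2ⁿ` on the `n`-th pulse `1 − t ∈ [sₙ/5, sₙ/4]`, supported in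
`1 − t ∈ (sₙ/6, sₙ/3)`, `a = 0` between pulses, `sₙ = 2^{−4n²}` (pulses sparse enough in log-time that the windows
`wₙ = 2^{−2n²}/4`, `wₙ² = sₙ/16`, see only the later, ever thinner pulses: `C(wₙ) ≤ 2048 |B₁|`), while at the peak
scales `pₙ = 2^{−2n²}` (`pₙ² = sₙ`) the load is `C(pₙ) ≥ κ 8ⁿ → ∞`; energy `≤ 32 |B₁|` (`a² √(1−t) ≤ 1`),
unbounded at `(1, 0)`.

Stubs (registered sub-goals of stmt-1424, one worker each; the field is written out as a lambda, generic in the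
amplitude `a : ℝ → ℝ`): `pulse_amplitude_exists` (W1), `pulse_energy` (W2), `pulse_windowCeiling` (W3),
`pulse_peakFloor` (W4), `pulse_unbounded` (W5), `pulse_smooth_divFree` (W6), `pulse_arith` (W7).
Assembly (lead): `pulsating_kinematicWitness`, `windowsForceTypeI_false_without_momentum`,
`sequentialTypeIExclusion_false_without_momentum`.
-/

noncomputable section

open MeasureTheory Set Metric Function
open scoped ENNReal ContDiff
open Literature.Analysis.FluidPDE

-- `Summit = Problem` for this summit; the tree lakefile sets `weak.linter.dupNamespace = false`.
set_option linter.dupNamespace false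

namespace Summit.NavierStokesRegularity.NavierStokesRegularity.Theorems.SequentialTypeIExclusion.Registered

/-- **W1 — the pulsating amplitude.** A function `a : ℝ → ℝ`, smooth on `(−∞, 1)`, nonnegative, vanishing at
`t = 0`, equal to `2ⁿ` on the `n`-th plateau `1 − t ∈ [sₙ/5, sₙ/4]` and supported, away from its zeros, in the
pulses `1 − t ∈ (sₘ/6, sₘ/3)` with `a ≤ 2ᵐ` there (`sₙ = (2^{4n²})⁻¹`). Construction: a locally finite sum of
`ContDiffBump`s centred at `1 − 9sₙ/40` with radii `sₙ/40 < sₙ/20`. -/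
theorem pulse_amplitude_exists :
    ∃ a : ℝ → ℝ, ContDiffOn ℝ (⊤ : ℕ∞) a (Set.Iio 1) ∧ (∀ t : ℝ, 0 ≤ a t) ∧ a 0 = 0 ∧
      (∀ (n : ℕ) (t : ℝ), 1 - t ∈ Set.Icc (((2 : ℝ) ^ (4 * n ^ 2))⁻¹ / 5) (((2 : ℝ) ^ (4 * n ^ 2))⁻¹ / 4) →
        a t = 2 ^ n) ∧
      (∀ t : ℝ, a t = 0 ∨ ∃ m : ℕ,
        1 - t ∈ Set.Ioo (((2 : ℝ) ^ (4 * m ^ 2))⁻¹ / 6) (((2 : ℝ) ^ (4 * m ^ 2))⁻¹ / 3) ∧ a t ≤ 2 ^ m) := by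
  sorry

/-- **W2 — energy of the pulsating eddy.** If `0 ≤ a t` and `(a t)² √(1 − t) ≤ 1` before `t = 1`, every slice from
time `0` on is in `L²` with `∫ ‖u t x‖² ≤ 32 |B₁|` (support in `B̄(0, 2√(1−t))`, `‖u‖² ≤ 4 (a t)²/(1 − t)` there,
`|B(0, 2√(1−t))| = 8 (1−t)^{3/2} |B₁|`; the slice is `0` for `t ≥ 1`). -/
theorem pulse_energy :
    ∀ a : ℝ → ℝ, (∀ t : ℝ, t < 1 → 0 ≤ a t) → (∀ t : ℝ, t < 1 → a t ^ 2 * Real.sqrt (1 - t) ≤ 1) →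
      ∀ t : ℝ, 0 ≤ t →
        MeasureTheory.MemLp ((fun (t : ℝ) (x : EuclideanSpace ℝ (Fin 3)) => if t < 1 then
          (a t * (1 - t)⁻¹ * expNegInvGlue (4 - ‖x‖ ^ 2 / (1 - t))) •
            (WithLp.toLp 2 ![-(x 1), x 0, 0] : EuclideanSpace ℝ (Fin 3)) else 0) t) 2 MeasureTheory.volume ∧
        ∫ x, ‖(fun (t : ℝ) (x : EuclideanSpace ℝ (Fin 3)) => if t < 1 then
          (a t * (1 - t)⁻¹ * expNegInvGlue (4 - ‖x‖ ^ 2 / (1 - t))) •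
            (WithLp.toLp 2 ![-(x 1), x 0, 0] : EuclideanSpace ℝ (Fin 3)) else 0) t x‖ ^ 2 ≤
          32 * (MeasureTheory.volume (Metric.ball (0 : EuclideanSpace ℝ (Fin 3)) 1)).toReal := by
  sorry

/-- **W3 — load ceiling at a window scale.** If `0 ≤ a` before `t = 1` and `(a t)³ ≤ K w (1 − t)^{−1/2}` on the
window `t ∈ (1 − w², 1)`, then `C(w; 1, 0) ≤ 128 K |B₁|`: every slice has `∫ ‖u t ·‖ₑ³ ≤ ofReal (64 (a t)³) |B₁|`
(`selfSimilarSwirl_loadCeiling_lintegral_slice_le` with `A = a t`), Tonelli on `Q_w(1,0) = (1 − w², 1) × B_w`,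
`∫_{1−w²}^{1} (1 − t)^{−1/2} dt = 2w`, and `(ofReal w²)⁻¹` cancels. -/
theorem pulse_windowCeiling :
    ∀ (a : ℝ → ℝ) (w K : ℝ), 0 < w → 0 ≤ K → (∀ t : ℝ, t < 1 → 0 ≤ a t) →
      (∀ t ∈ Set.Ioo (1 - w ^ 2) 1, a t ^ 3 ≤ K * w * (1 - t) ^ (-(1 / 2 : ℝ))) →
      Literature.Analysis.FluidPDE.cknC w (((1 : ℝ), (0 : EuclideanSpace ℝ (Fin 3))) : ℝ × EuclideanSpace ℝ (Fin 3))
          (fun (t : ℝ) (x : EuclideanSpace ℝ (Fin 3)) => if t < 1 then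
            (a t * (1 - t)⁻¹ * expNegInvGlue (4 - ‖x‖ ^ 2 / (1 - t))) •
              (WithLp.toLp 2 ![-(x 1), x 0, 0] : EuclideanSpace ℝ (Fin 3)) else 0) ≤
        ENNReal.ofReal (128 * K * (MeasureTheory.volume (Metric.ball (0 : EuclideanSpace ℝ (Fin 3)) 1)).toReal) := by
  sorry

/-- **W4 — load floor at a peak scale.** There is a universal `κ > 0` such that if `a = A ≥ 0` on the time window
`t ∈ (1 − r²/4, 1 − r²/5)`, then `ofReal (κ A³) ≤ C(r; 1, 0)` (the proof of `stub_selfSimilarSwirl_loadFloor`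
verbatim: on that window and the ball `B((3r/5) e₀, r/20)` the speed is `≥ A (4/r²) expNegInvGlue 1 (11r/20)`,
then `kinWitness_cknC_lowerBound_of_le_norm`; `κ = (1331/20000000) (expNegInvGlue 1)³ |B₁|`). -/
theorem pulse_peakFloor :
    ∃ κ : ℝ, 0 < κ ∧ ∀ (a : ℝ → ℝ) (A r : ℝ), 0 ≤ A → 0 < r →
      (∀ t ∈ Set.Ioo (1 - r ^ 2 / 4) (1 - r ^ 2 / 5), a t = A) →
      ENNReal.ofReal (κ * A ^ 3) ≤
        Literature.Analysis.FluidPDE.cknC r (((1 : ℝ), (0 : EuclideanSpace ℝ (Fin 3))) : ℝ × EuclideanSpace ℝ (Fin 3))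
          (fun (t : ℝ) (x : EuclideanSpace ℝ (Fin 3)) => if t < 1 then
            (a t * (1 - t)⁻¹ * expNegInvGlue (4 - ‖x‖ ^ 2 / (1 - t))) •
              (WithLp.toLp 2 ![-(x 1), x 0, 0] : EuclideanSpace ℝ (Fin 3)) else 0) := by
  sorry

/-- **W5 — unboundedness at `(1, 0)`.** If `a ≥ 2ⁿ` on the peak windows `t ∈ (1 − pₙ²/4, 1 − pₙ²/5)`,
`pₙ = (2^{2n²})⁻¹`, and `a ≥ 0` before `t = 1`, then `u` is unbounded on every `(1 − ρ², 1) × B(0, ρ)`: on the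
`n`-th window and the ball `B((3pₙ/5) e₀, pₙ/20)` the speed is `≥ 2ⁿ (4/pₙ²) expNegInvGlue 1 (11pₙ/20) ≥ 2ⁿ · 2`
(`selfSimilarSwirl_loadFloor_pointwise` with `A = a t`, `pₙ ≤ 1`), and `pₙ → 0`. -/
theorem pulse_unbounded :
    ∀ a : ℝ → ℝ, (∀ t : ℝ, t < 1 → 0 ≤ a t) →
      (∀ (n : ℕ), ∀ t ∈ Set.Ioo (1 - (((2 : ℝ) ^ (2 * n ^ 2))⁻¹) ^ 2 / 4) (1 - (((2 : ℝ) ^ (2 * n ^ 2))⁻¹) ^ 2 / 5),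
        (2 : ℝ) ^ n ≤ a t) →
      ∀ ρ : ℝ, 0 < ρ → ∀ M : ℝ, ∃ t ∈ Set.Ioo (1 - ρ ^ 2) 1,
        ∃ x ∈ Metric.ball (0 : EuclideanSpace ℝ (Fin 3)) ρ,
          M < ‖(fun (t : ℝ) (x : EuclideanSpace ℝ (Fin 3)) => if t < 1 then
            (a t * (1 - t)⁻¹ * expNegInvGlue (4 - ‖x‖ ^ 2 / (1 - t))) •
              (WithLp.toLp 2 ![-(x 1), x 0, 0] : EuclideanSpace ℝ (Fin 3)) else 0) t x‖ := by
  sorry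

/-- **W6 — smoothness before the blow-up time and incompressibility.** For an amplitude smooth on `(−∞, 1)` the
field is jointly smooth on `[0, 1) × ℝ³` (`kinWitness_contDiffOn_swirlField` with `g t = a t (1 − t)⁻¹`,
`h t = 1 − t`, `φ s = expNegInvGlue (4 − s)` on `S = (−∞, 1)`), and every slice is divergence free
(`kinWitness_isDivFree_swirlField`; the zero field after `t = 1`). -/
theorem pulse_smooth_divFree :
    ∀ a : ℝ → ℝ, ContDiffOn ℝ (⊤ : ℕ∞) a (Set.Iio 1) →
      Literature.Analysis.FluidPDE.IsSmoothSpaceTimeOn (Set.Ico 0 1) (fun (t : ℝ) (x : EuclideanSpace ℝ (Fin 3)) => if t < 1 then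
          (a t * (1 - t)⁻¹ * expNegInvGlue (4 - ‖x‖ ^ 2 / (1 - t))) •
            (WithLp.toLp 2 ![-(x 1), x 0, 0] : EuclideanSpace ℝ (Fin 3)) else 0) ∧
      ∀ t : ℝ, Literature.Analysis.FluidPDE.VectorCalculus.IsDivFree ((fun (t : ℝ) (x : EuclideanSpace ℝ (Fin 3)) => if t < 1 then
          (a t * (1 - t)⁻¹ * expNegInvGlue (4 - ‖x‖ ^ 2 / (1 - t))) •
            (WithLp.toLp 2 ![-(x 1), x 0, 0] : EuclideanSpace ℝ (Fin 3)) else 0) t) := by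
  sorry

/-- **W7 — the arithmetic of the pulse train** (`sₘ = (2^{4m²})⁻¹`, window `wₙ = (2^{2n²} · 4)⁻¹`, `wₙ² = sₙ/16`):
(a) a pulse `s ∈ (sₘ/6, sₘ/3)` inside the `n`-th window `s < sₙ/16` is a LATER pulse, `n < m`;
(b) on a later pulse the amplitude cube `8ᵐ` is below the window majorant `16 wₙ s^{−1/2}`
(`s^{−1/2} > 2^{2m²}`, `2^{2m² − 2n² + 2} ≥ 2^{4m} ≥ 8ᵐ` for `n ≤ m − 1`);
(c) on every pulse `4ᵐ √s ≤ 1` (`√s < 2^{−2m²}`, `2m ≤ 2m²`; `m = 0`: `s < 1/3`). -/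
theorem pulse_arith :
    (∀ (n m : ℕ) (s : ℝ),
        s ∈ Set.Ioo (((2 : ℝ) ^ (4 * m ^ 2))⁻¹ / 6) (((2 : ℝ) ^ (4 * m ^ 2))⁻¹ / 3) →
        s < ((2 : ℝ) ^ (4 * n ^ 2))⁻¹ / 16 → n < m) ∧
    (∀ (n m : ℕ) (s : ℝ), n < m →
        s ∈ Set.Ioo (((2 : ℝ) ^ (4 * m ^ 2))⁻¹ / 6) (((2 : ℝ) ^ (4 * m ^ 2))⁻¹ / 3) →
        ((2 : ℝ) ^ m) ^ 3 ≤ 16 * ((2 : ℝ) ^ (2 * n ^ 2) * 4)⁻¹ * s ^ (-(1 / 2 : ℝ))) ∧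
    (∀ (m : ℕ) (s : ℝ),
        s ∈ Set.Ioo (((2 : ℝ) ^ (4 * m ^ 2))⁻¹ / 6) (((2 : ℝ) ^ (4 * m ^ 2))⁻¹ / 3) →
        ((2 : ℝ) ^ m) ^ 2 * Real.sqrt s ≤ 1) := by
  sorry

/-- **The pulsating kinematic witness (regime I of the sibling crux S2; an NSI-violator).** A field
`u : ℝ → ℝ³ → ℝ³`, jointly smooth on `[0,1) × ℝ³`, divergence free at every time, of energy `≤ 32|B₁|` from
time `0` on, with ZERO datum, which at the space–time point `(1, 0)` has TYPE-I WINDOWS — `C(r; 1, 0) ≤ M₀`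
(`M₀ = 2048 |B₁|`) at arbitrarily small scales — and UNBOUNDED LOAD in between — `C(r; 1, 0) > M` at arbitrarily
small scales, for every `M` — and is unbounded on every `(1 − ρ², 1) × B(0, ρ)`. -/
theorem pulsating_kinematicWitness :
    ∃ u : ℝ → EuclideanSpace ℝ (Fin 3) → EuclideanSpace ℝ (Fin 3),
      Literature.Analysis.FluidPDE.IsSmoothSpaceTimeOn (Set.Ico 0 1) u ∧
      (∀ t : ℝ, Literature.Analysis.FluidPDE.VectorCalculus.IsDivFree (u t)) ∧
      (∃ E₀ : ℝ, ∀ t : ℝ, 0 ≤ t → MeasureTheory.MemLp (u t) 2 MeasureTheory.volume ∧ ∫ x, ‖u t x‖ ^ 2 ≤ E₀) ∧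
      u 0 = 0 ∧
      (∃ M₀ : ℝ, ∀ r₀ : ℝ, 0 < r₀ → ∃ r ∈ Set.Ioo 0 r₀,
        Literature.Analysis.FluidPDE.cknC r (((1 : ℝ), (0 : EuclideanSpace ℝ (Fin 3))) : ℝ × EuclideanSpace ℝ (Fin 3)) u ≤
          ENNReal.ofReal M₀) ∧
      (∀ M : ℝ, ∀ r₁ : ℝ, 0 < r₁ → ∃ r ∈ Set.Ioo 0 r₁,
        ENNReal.ofReal M <
          Literature.Analysis.FluidPDE.cknC r (((1 : ℝ), (0 : EuclideanSpace ℝ (Fin 3))) : ℝ × EuclideanSpace ℝ (Fin 3)) u) ∧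
      (∀ ρ : ℝ, 0 < ρ → ∀ M : ℝ, ∃ t ∈ Set.Ioo (1 - ρ ^ 2) 1,
        ∃ x ∈ Metric.ball (0 : EuclideanSpace ℝ (Fin 3)) ρ, M < ‖u t x‖) := by
  -- the universal constants
  have hvtop : volume (Metric.ball (0 : EuclideanSpace ℝ (Fin 3)) 1) ≠ ⊤ := measure_ball_lt_top.ne
  have hVpos : 0 < (volume (Metric.ball (0 : EuclideanSpace ℝ (Fin 3)) 1)).toReal :=
    ENNReal.toReal_pos (Metric.measure_ball_pos volume (0 : EuclideanSpace ℝ (Fin 3)) one_pos).ne' hvtop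
  set V : ℝ := (volume (Metric.ball (0 : EuclideanSpace ℝ (Fin 3)) 1)).toReal with hV
  -- the amplitude and the field
  obtain ⟨a, ha_smooth, ha_nonneg, ha0, ha_plateau, ha_supp⟩ := pulse_amplitude_exists
  obtain ⟨harith_a, harith_b, harith_c⟩ := pulse_arith
  obtain ⟨κ, hκ, hfloor⟩ := pulse_peakFloor
  set F : ℝ → EuclideanSpace ℝ (Fin 3) → EuclideanSpace ℝ (Fin 3) :=
    (fun (t : ℝ) (x : EuclideanSpace ℝ (Fin 3)) => if t < 1 then
      (a t * (1 - t)⁻¹ * expNegInvGlue (4 - ‖x‖ ^ 2 / (1 - t))) •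
        (WithLp.toLp 2 ![-(x 1), x 0, 0] : EuclideanSpace ℝ (Fin 3)) else 0) with hF
  have ha_nonneg' : ∀ t : ℝ, t < 1 → 0 ≤ a t := fun t _ => ha_nonneg t
  -- (1) smoothness and incompressibility
  obtain ⟨hsm, hdiv⟩ := pulse_smooth_divFree a ha_smooth
  -- (2) energy: `(a t)² √(1 − t) ≤ 1`
  have hE : ∀ t : ℝ, 0 ≤ t → MemLp (F t) 2 volume ∧ ∫ x, ‖F t x‖ ^ 2 ≤ 32 * V := by
    refine pulse_energy a ha_nonneg' (fun t ht => ?_)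
    rcases ha_supp t with h0 | ⟨m, hm, hle⟩
    · rw [h0]; simp
    · have h1 := harith_c m (1 - t) hm
      have h2 : a t ^ 2 ≤ ((2 : ℝ) ^ m) ^ 2 := pow_le_pow_left₀ (ha_nonneg t) hle 2
      exact (mul_le_mul_of_nonneg_right h2 (Real.sqrt_nonneg _)).trans h1
  -- (3) zero datum
  have hF0 : F 0 = 0 := by
    funext x
    simp only [hF, if_pos (zero_lt_one' ℝ), ha0, zero_mul, zero_smul, Pi.zero_apply]
  -- (4) windows `wₙ = (2^{2n²} · 4)⁻¹`: `C(wₙ) ≤ 128 · 16 · |B₁|`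
  have hwin : ∀ n : ℕ, cknC (((2 : ℝ) ^ (2 * n ^ 2) * 4)⁻¹)
      (((1 : ℝ), (0 : EuclideanSpace ℝ (Fin 3))) : ℝ × EuclideanSpace ℝ (Fin 3)) F ≤
        ENNReal.ofReal (128 * 16 * V) := by
    intro n
    have hw : (0 : ℝ) < ((2 : ℝ) ^ (2 * n ^ 2) * 4)⁻¹ := by positivity
    refine pulse_windowCeiling a _ 16 hw (by norm_num) ha_nonneg' (fun t ht => ?_)
    have hs : 0 < 1 - t := by linarith [ht.2]
    rcases ha_supp t with h0 | ⟨m, hm, hle⟩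
    · rw [h0]
      have : (0 : ℝ) ≤ 16 * ((2 : ℝ) ^ (2 * n ^ 2) * 4)⁻¹ * (1 - t) ^ (-(1 / 2 : ℝ)) := by positivity
      simpa using this
    · -- the window sees only later pulses
      have hsw : 1 - t < ((2 : ℝ) ^ (4 * n ^ 2))⁻¹ / 16 := by
        have h1 : 1 - t < (((2 : ℝ) ^ (2 * n ^ 2) * 4)⁻¹) ^ 2 := by linarith [ht.1]
        have h2 : (((2 : ℝ) ^ (2 * n ^ 2) * 4)⁻¹) ^ 2 = ((2 : ℝ) ^ (4 * n ^ 2))⁻¹ / 16 := by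
          rw [inv_pow, mul_pow, ← pow_mul]
          have : (2 * n ^ 2 * 2 : ℕ) = 4 * n ^ 2 := by ring
          rw [this]
          field_simp
          norm_num
        rwa [h2] at h1
      have hnm : n < m := harith_a n m (1 - t) hm hsw
      have h3 : a t ^ 3 ≤ ((2 : ℝ) ^ m) ^ 3 := pow_le_pow_left₀ (ha_nonneg t) hle 3
      exact h3.trans (harith_b n m (1 - t) hnm hm)
  -- (5) peaks `pₙ = (2^{2n²})⁻¹`: `C(pₙ) ≥ κ 8ⁿ`
  have hpeak : ∀ n : ℕ, ENNReal.ofReal (κ * ((2 : ℝ) ^ n) ^ 3) ≤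
      cknC (((2 : ℝ) ^ (2 * n ^ 2))⁻¹)
        (((1 : ℝ), (0 : EuclideanSpace ℝ (Fin 3))) : ℝ × EuclideanSpace ℝ (Fin 3)) F := by
    intro n
    have hp : (0 : ℝ) < ((2 : ℝ) ^ (2 * n ^ 2))⁻¹ := by positivity
    refine hfloor a _ _ (by positivity) hp (fun t ht => ha_plateau n t ⟨?_, ?_⟩)
    · have h2 : (((2 : ℝ) ^ (2 * n ^ 2))⁻¹) ^ 2 = ((2 : ℝ) ^ (4 * n ^ 2))⁻¹ := by
        rw [inv_pow, ← pow_mul]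
        have : (2 * n ^ 2 * 2 : ℕ) = 4 * n ^ 2 := by ring
        rw [this]
      have := ht.2
      rw [h2] at this
      linarith
    · have h2 : (((2 : ℝ) ^ (2 * n ^ 2))⁻¹) ^ 2 = ((2 : ℝ) ^ (4 * n ^ 2))⁻¹ := by
        rw [inv_pow, ← pow_mul]
        have : (2 * n ^ 2 * 2 : ℕ) = 4 * n ^ 2 := by ring
        rw [this]
      have := ht.1
      rw [h2] at this
      linarith
  -- (6) unboundedness
  have hunb := pulse_unbounded a ha_nonneg' (fun n t ht => (ha_plateau n t ⟨?g1, ?g2⟩).symm.le)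
  case g1 =>
    have h2 : (((2 : ℝ) ^ (2 * n ^ 2))⁻¹) ^ 2 = ((2 : ℝ) ^ (4 * n ^ 2))⁻¹ := by
      rw [inv_pow, ← pow_mul]
      have : (2 * n ^ 2 * 2 : ℕ) = 4 * n ^ 2 := by ring
      rw [this]
    have := ht.2
    rw [h2] at this
    linarith
  case g2 =>
    have h2 : (((2 : ℝ) ^ (2 * n ^ 2))⁻¹) ^ 2 = ((2 : ℝ) ^ (4 * n ^ 2))⁻¹ := by
      rw [inv_pow, ← pow_mul]
      have : (2 * n ^ 2 * 2 : ℕ) = 4 * n ^ 2 := by ring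
      rw [this]
    have := ht.1
    rw [h2] at this
    linarith
  -- scales go to zero: `(2^{2n²})⁻¹ ≤ (2^n)⁻¹ < r₀` for `n` large
  have hsmall : ∀ r₀ : ℝ, 0 < r₀ → ∀ N : ℕ, ∃ n : ℕ, N ≤ n ∧ ((2 : ℝ) ^ (2 * n ^ 2))⁻¹ < r₀ := by
    intro r₀ hr₀ N
    obtain ⟨k, hk⟩ := exists_nat_gt r₀⁻¹
    refine ⟨max N k, le_max_left _ _, ?_⟩
    have hk' : (k : ℝ) ≤ (max N k : ℕ) := by exact_mod_cast le_max_right N k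
    have h1 : ((max N k : ℕ) : ℝ) < (2 : ℝ) ^ (max N k) := by exact_mod_cast Nat.lt_two_pow_self
    have h2 : (2 : ℝ) ^ (max N k) ≤ (2 : ℝ) ^ (2 * (max N k) ^ 2) :=
      pow_le_pow_right₀ (by norm_num) (by nlinarith)
    rw [inv_lt_comm₀ (by positivity) hr₀]
    linarith
  refine ⟨F, hsm, hdiv, ⟨32 * V, hE⟩, hF0, ⟨128 * 16 * V, fun r₀ hr₀ => ?_⟩, fun M r₁ hr₁ => ?_, hunb⟩
  · -- a window below `r₀`
    obtain ⟨n, -, hn⟩ := hsmall r₀ hr₀ 0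
    refine ⟨((2 : ℝ) ^ (2 * n ^ 2) * 4)⁻¹, ⟨by positivity, ?_⟩, hwin n⟩
    calc ((2 : ℝ) ^ (2 * n ^ 2) * 4)⁻¹ ≤ ((2 : ℝ) ^ (2 * n ^ 2))⁻¹ := by
          apply inv_anti₀ (by positivity); linarith [pow_pos (two_pos : (0:ℝ) < 2) (2 * n ^ 2)]
      _ < r₀ := hn
  · -- a peak below `r₁` with `κ 8ⁿ > M`
    obtain ⟨N, hN⟩ := exists_nat_gt (M / κ)
    obtain ⟨n, hNn, hn⟩ := hsmall r₁ hr₁ N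
    refine ⟨((2 : ℝ) ^ (2 * n ^ 2))⁻¹, ⟨by positivity, hn⟩, lt_of_lt_of_le ?_ (hpeak n)⟩
    have hpos : 0 < κ * ((2 : ℝ) ^ n) ^ 3 := by positivity
    rw [ENNReal.ofReal_lt_ofReal_iff hpos]
    have hn1 : (N : ℝ) ≤ n := by exact_mod_cast hNn
    have hn2 : (n : ℝ) < (2 : ℝ) ^ n := by exact_mod_cast Nat.lt_two_pow_self
    have hn3 : (2 : ℝ) ^ n ≤ ((2 : ℝ) ^ n) ^ 3 := le_self_pow₀ (one_le_pow₀ (by norm_num)) (by norm_num)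
    have : M / κ < ((2 : ℝ) ^ n) ^ 3 := by linarith
    rwa [div_lt_iff₀ hκ, mul_comm] at this

/-- **No-scale-intermittency is false without the momentum equation** (registered sub-goal). The registered OPEN
stub `stub_windowsForceTypeI` of the line (Type-I windows at arbitrarily small scales force a centred cubic Type-I
bound) with its Navier–Stokes class hypotheses (`IsClassicalNSSolutionOn (Ico 0 T) 1 0 u p`,
`IsLerayHopfOn T 1 0 (u 0) u`) replaced by the KINEMATIC class — jointly smooth on `[0,T) × ℝ³`, divergence free at
every time, uniformly bounded energy from time `0`, rapidly decaying datum — is FALSE: the pulsating witness has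
windows `C ≤ M₀` below every scale at `(1, 0)` but `C > M'` below every scale for every `M'`. Together with the
refuter's `Mutation2.lean` (S1 is false for the Navier–Stokes class WITHOUT the energy class: parasitic solutions),
this places NSI — and S1 — as needing BOTH the momentum equation and the energy class. -/
theorem windowsForceTypeI_false_without_momentum :
    ¬ (∀ M : ℝ, ∀ T : ℝ, 0 < T →
      ∀ (u : ℝ → EuclideanSpace ℝ (Fin 3) → EuclideanSpace ℝ (Fin 3)),
        Literature.Analysis.FluidPDE.IsSmoothSpaceTimeOn (Set.Ico 0 T) u →
        (∀ t : ℝ, Literature.Analysis.FluidPDE.VectorCalculus.IsDivFree (u t)) →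
        (∃ E₀ : ℝ, ∀ t : ℝ, 0 ≤ t → MeasureTheory.MemLp (u t) 2 MeasureTheory.volume ∧ ∫ x, ‖u t x‖ ^ 2 ≤ E₀) →
        Literature.Analysis.FluidPDE.HasRapidSpatialDecay (u 0) →
        ∀ x₀ : EuclideanSpace ℝ (Fin 3),
          (∀ r₀ : ℝ, 0 < r₀ → ∃ r ∈ Set.Ioo 0 r₀,
            Literature.Analysis.FluidPDE.cknC r ((T, x₀) : ℝ × EuclideanSpace ℝ (Fin 3)) u ≤ ENNReal.ofReal M) →
          ∃ M' : ℝ, ∃ r₁ : ℝ, 0 < r₁ ∧ ∀ r ∈ Set.Ioo 0 r₁,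
            Literature.Analysis.FluidPDE.cknC r ((T, x₀) : ℝ × EuclideanSpace ℝ (Fin 3)) u ≤ ENNReal.ofReal M') := by
  intro h
  obtain ⟨u, hsm, hdiv, hE, hu0, ⟨M₀, hwin⟩, hpeak, -⟩ := pulsating_kinematicWitness
  have hdec : HasRapidSpatialDecay (u 0) := by
    intro n K
    refine ⟨0, fun x => ?_⟩
    rw [hu0]
    simp
  obtain ⟨M', r₁, hr₁, hbd⟩ := h M₀ 1 one_pos u hsm hdiv hE hdec 0 hwin
  obtain ⟨r, hr, hlt⟩ := hpeak M' r₁ hr₁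
  exact absurd (hbd r hr) (not_le.2 hlt)

/-- **S1 is false without the momentum equation** (registered sub-goal). The crux `SequentialTypeIExclusion`
VERBATIM with its Navier–Stokes class hypotheses replaced by the kinematic class (as in
`windowsForceTypeI_false_without_momentum`) is FALSE: the pulsating witness has Type-I windows at `(1, 0)` and
is unbounded on every `(1 − ρ², 1) × B(0, ρ)`. (The sup-form S1_sup fails kinematically too — by the exactly
self-similar regime-A eddy `coherentTypeI_kinematicWitness` of the sibling crux, whose load is bounded at EVERY
scale: the morphology Navier–Stokes excludes by Nečas–Růžička–Šverák / Tsai.) -/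
theorem sequentialTypeIExclusion_false_without_momentum :
    ¬ (∀ M : ℝ, ∀ T : ℝ, 0 < T →
      ∀ (u : ℝ → EuclideanSpace ℝ (Fin 3) → EuclideanSpace ℝ (Fin 3)),
        Literature.Analysis.FluidPDE.IsSmoothSpaceTimeOn (Set.Ico 0 T) u →
        (∀ t : ℝ, Literature.Analysis.FluidPDE.VectorCalculus.IsDivFree (u t)) →
        (∃ E₀ : ℝ, ∀ t : ℝ, 0 ≤ t → MeasureTheory.MemLp (u t) 2 MeasureTheory.volume ∧ ∫ x, ‖u t x‖ ^ 2 ≤ E₀) →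
        Literature.Analysis.FluidPDE.HasRapidSpatialDecay (u 0) →
        ∀ x₀ : EuclideanSpace ℝ (Fin 3),
          (∀ r₀ : ℝ, 0 < r₀ → ∃ r ∈ Set.Ioo 0 r₀,
            Literature.Analysis.FluidPDE.cknC r ((T, x₀) : ℝ × EuclideanSpace ℝ (Fin 3)) u ≤ ENNReal.ofReal M) →
          ∃ ρ : ℝ, 0 < ρ ∧ ∃ M' : ℝ, ∀ t ∈ Set.Ioo (T - ρ ^ 2) T, ∀ x ∈ Metric.ball x₀ ρ,
            ‖u t x‖ ≤ M') := by
  intro h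
  obtain ⟨u, hsm, hdiv, hE, hu0, ⟨M₀, hwin⟩, -, hunb⟩ := pulsating_kinematicWitness
  have hdec : HasRapidSpatialDecay (u 0) := by
    intro n K
    refine ⟨0, fun x => ?_⟩
    rw [hu0]
    simp
  obtain ⟨ρ, hρ, M', hbd⟩ := h M₀ 1 one_pos u hsm hdiv hE hdec 0 hwin
  obtain ⟨t, ht, x, hx, hlt⟩ := hunb ρ hρ M'
  exact absurd (hbd t ht x hx) (not_le.2 hlt)

end Summit.NavierStokesRegularity.NavierStokesRegularity.Theorems.SequentialTypeIExclusion.Registered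

end
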